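import Literature.AlgebraicGeometry.HodgeTheory.HodgeClassesProductSpanCMCurves
import Literature.AlgebraicGeometry.Motives.AbelianVarietyProductDimProofs
import Literature.AlgebraicGeometry.Motives.AbelianVarietyCohomologyExteriorH1
import HarnessLib

/-!
# Künneth in degree one for a product of two complex abelian varieties, in basis form

Family `hodge`, layer `Literature/AlgebraicGeometry/Pohlmann1968`; written for the cell `pub-hodgecm2` (COR-CM,
count-neutral own-lane brick of seat b25) as the first set-up file of
`Pohlmann1968/HodgeClassesProductSpanCMProducts` (Hodge classes on `X × Y` for CM products `X`, `Y` with blockwise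
independent Galois actions are exterior products of Hodge classes of the factors — module docstring there).

PROVED here (theorems only; no definition, no named fact, no `sorry`), for complex abelian varieties `X`, `Y`:
* `map_fst_one_injective`, `map_snd_one_injective`, `disjoint_range_map_fst_map_snd_one` — `pr_X^*`, `pr_Y^*` are
  injective on `H¹` with trivially intersecting images (restriction to the slices `(𝟙, 0)`, `(0, 𝟙)`, the tree's
  `sliceLeft_map_fst`, `sliceLeft_map_snd_one`, … of `HodgeTheory/HodgeClassesProductSpanCMCurves`);
* `cupProduct_map_map_mem_span` — bilinearity book-keeping for `(a, b) ↦ F a ∪ G b`;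
* `exists_prodBasis_one` — bases `w` of `H¹(X(ℂ); ℂ)` and `w'` of `H¹(Y(ℂ); ℂ)` give the basis `pr_X^* w ⊔ pr_Y^* w'`
  of `H¹((X × Y)(ℂ); ℂ)` indexed by the disjoint union of the index types ("`H¹(X × Y) = pr_X^* H¹(X) ⊕ pr_Y^* H¹(Y)`",
  Künneth in degree one; spanning by the count `b₁ = 2 dim`, the tree's `AbelianVariety.finrank_complexBetti_one`
  and `AbelianVariety.dim_prod`).

## References
* [HatcherAT2002] A. Hatcher, *Algebraic Topology*, §3.2 Thm. 3.15–3.16 (Künneth formula).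
* [LangeBirkenhake1992] H. Lange, Ch. Birkenhake, *Complex Abelian Varieties*, §1.1 (cohomology of complex tori).
-/

noncomputable section

open CategoryTheory CategoryTheory.Limits

namespace Literature.AlgebraicGeometry.Pohlmann1968

open Literature.AlgebraicGeometry.Motives (AbelianVariety)
open Literature.AlgebraicGeometry.HodgeTheory
open Literature.AlgebraicTopology.SingularHomology

/-! ### Künneth in degree one for `X × Y`, in basis form -/

section ProdBasis

variable {X Y : AbelianVariety ℂ}

/-- `pr_X^*` is injective on `H¹` (left inverse: restriction to the slice `(𝟙, 0)`). [cite: LangeBirkenhake1992, §1.1] -/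
theorem map_fst_one_injective :
    Function.Injective (complexBetti.map (AbelianVariety.fst X Y).hom.hom.hom 1) := by
  intro a a' h
  have h' := congrArg (complexBetti.map (AbelianVariety.prodLift (𝟙 X) (0 : X ⟶ Y)).hom.hom.hom 1) h
  change (complexBetti.map (AbelianVariety.prodLift (𝟙 X) (0 : X ⟶ Y)).hom.hom.hom 1).hom
      ((complexBetti.map (AbelianVariety.fst X Y).hom.hom.hom 1).hom a) =
    (complexBetti.map (AbelianVariety.prodLift (𝟙 X) (0 : X ⟶ Y)).hom.hom.hom 1).hom
      ((complexBetti.map (AbelianVariety.fst X Y).hom.hom.hom 1).hom a') at h'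
  rwa [sliceLeft_map_fst, sliceLeft_map_fst] at h'

/-- `pr_Y^*` is injective on `H¹` (left inverse: restriction to the slice `(0, 𝟙)`). [cite: LangeBirkenhake1992, §1.1] -/
theorem map_snd_one_injective :
    Function.Injective (complexBetti.map (AbelianVariety.snd X Y).hom.hom.hom 1) := by
  intro b b' h
  have h' := congrArg (complexBetti.map (AbelianVariety.prodLift (0 : Y ⟶ X) (𝟙 Y)).hom.hom.hom 1) h
  change (complexBetti.map (AbelianVariety.prodLift (0 : Y ⟶ X) (𝟙 Y)).hom.hom.hom 1).hom
      ((complexBetti.map (AbelianVariety.snd X Y).hom.hom.hom 1).hom b) =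
    (complexBetti.map (AbelianVariety.prodLift (0 : Y ⟶ X) (𝟙 Y)).hom.hom.hom 1).hom
      ((complexBetti.map (AbelianVariety.snd X Y).hom.hom.hom 1).hom b') at h'
  rwa [sliceRight_map_snd, sliceRight_map_snd] at h'

/-- `pr_X^* H¹(X) ∩ pr_Y^* H¹(Y) = 0` inside `H¹(X × Y)` (restrict to the slice `(𝟙, 0)`, on which `pr_Y^*` dies in
degree one). [cite: LangeBirkenhake1992, §1.1] -/
theorem disjoint_range_map_fst_map_snd_one :
    Disjoint (LinearMap.range (complexBetti.map (AbelianVariety.fst X Y).hom.hom.hom 1).hom)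
      (LinearMap.range (complexBetti.map (AbelianVariety.snd X Y).hom.hom.hom 1).hom) := by
  rw [Submodule.disjoint_def]
  rintro z ⟨a, rfl⟩ ⟨b, hb⟩
  have h := congrArg (complexBetti.map (AbelianVariety.prodLift (𝟙 X) (0 : X ⟶ Y)).hom.hom.hom 1).hom hb
  rw [sliceLeft_map_snd_one, sliceLeft_map_fst] at h
  rw [← h, map_zero]

/-- **Künneth in degree one for a product of complex abelian varieties, basis form**: bases `w` of `H¹(X(ℂ); ℂ)`
and `w'` of `H¹(Y(ℂ); ℂ)` give the basis `pr_X^* w ⊔ pr_Y^* w'` of `H¹((X × Y)(ℂ); ℂ)`, indexed by the disjoint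
union of the index types (independence by the two slices, spanning by `b₁(X × Y) = 2 dim (X × Y) = b₁(X) + b₁(Y)`).
[cite: HatcherAT2002, §3.2 Thm. 3.15] [cite: LangeBirkenhake1992, §1.1] -/
theorem exists_prodBasis_one {ιX ιY : Type} [Fintype ιX] [Fintype ιY]
    (w : Module.Basis ιX ℂ (complexBetti X.X 1)) (w' : Module.Basis ιY ℂ (complexBetti Y.X 1)) :
    ∃ u : Module.Basis (ιX ⊕ ιY) ℂ (complexBetti (X.prod Y).X 1),
      (∀ i, u (Sum.inl i) = complexBetti.map (AbelianVariety.fst X Y).hom.hom.hom 1 (w i)) ∧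
      ∀ j, u (Sum.inr j) = complexBetti.map (AbelianVariety.snd X Y).hom.hom.hom 1 (w' j) := by
  classical
  have hli : LinearIndependent ℂ (Sum.elim
      (fun i => complexBetti.map (AbelianVariety.fst X Y).hom.hom.hom 1 (w i))
      (fun j => complexBetti.map (AbelianVariety.snd X Y).hom.hom.hom 1 (w' j))) := by
    refine linearIndependent_sum.2 ⟨?_, ?_, ?_⟩
    · exact (w.linearIndependent.map' (complexBetti.map (AbelianVariety.fst X Y).hom.hom.hom 1).hom
        (LinearMap.ker_eq_bot_of_injective map_fst_one_injective))
    · exact (w'.linearIndependent.map' (complexBetti.map (AbelianVariety.snd X Y).hom.hom.hom 1).hom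
        (LinearMap.ker_eq_bot_of_injective map_snd_one_injective))
    · refine Disjoint.mono ?_ ?_ disjoint_range_map_fst_map_snd_one
      · rw [Submodule.span_le]
        rintro _ ⟨i, rfl⟩
        exact ⟨w i, rfl⟩
      · rw [Submodule.span_le]
        rintro _ ⟨j, rfl⟩
        exact ⟨w' j, rfl⟩
  have hcard : Fintype.card (ιX ⊕ ιY) = Module.finrank ℂ (complexBetti (X.prod Y).X 1) := by
    rw [Fintype.card_sum, Motives.AbelianVariety.finrank_complexBetti_one, Motives.AbelianVariety.dim_prod,
      ← Module.finrank_eq_card_basis w, ← Module.finrank_eq_card_basis w',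
      Motives.AbelianVariety.finrank_complexBetti_one, Motives.AbelianVariety.finrank_complexBetti_one]
    ring
  haveI : Module.Finite ℂ (complexBetti (X.prod Y).X 1) :=
    Motives.abelianVarietyCohomologyExteriorH1_holds.finite_one (X.prod Y)
  refine ⟨basisOfLinearIndependentOfCardEqFinrank' _ hli hcard, fun i => ?_, fun j => ?_⟩
  · rw [coe_basisOfLinearIndependentOfCardEqFinrank']; rfl
  · rw [coe_basisOfLinearIndependentOfCardEqFinrank']; rfl

end ProdBasis

/-! ### Bilinearity book-keeping for exterior products -/

section Bilinear

/-- If `a ∈ span S` and `b ∈ span T` then `F a ∪ G b` lies in the span of the `F s ∪ G t`, `s ∈ S`, `t ∈ T`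
— bilinearity of the cup product (`Submodule.map₂_span_span`). [cite: HatcherAT2002, §3.2 (the cup product is bilinear)] -/
theorem cupProduct_map_map_mem_span {Z : Type} [TopologicalSpace Z] {i j k : ℕ} (h : i + j = k)
    {M₁ M₂ : Type*} [AddCommGroup M₁] [Module ℂ M₁] [AddCommGroup M₂] [Module ℂ M₂]
    (F : M₁ →ₗ[ℂ] singularCohomology ℂ ℂ Z i) (G : M₂ →ₗ[ℂ] singularCohomology ℂ ℂ Z j)
    {S : Set M₁} {T : Set M₂} {a : M₁} {b : M₂} (ha : a ∈ Submodule.span ℂ S)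
    (hb : b ∈ Submodule.span ℂ T) :
    cupProduct h (F a) (G b) ∈
      Submodule.span ℂ {z | ∃ s ∈ S, ∃ t ∈ T, z = cupProduct h (F s) (G t)} := by
  have hmem : ((cupProduct (R := ℂ) (X := Z) h).compl₁₂ F G) a b ∈
      Submodule.map₂ ((cupProduct (R := ℂ) (X := Z) h).compl₁₂ F G) (Submodule.span ℂ S)
        (Submodule.span ℂ T) :=
    Submodule.apply_mem_map₂ _ ha hb
  rw [Submodule.map₂_span_span] at hmem
  refine Submodule.span_mono ?_ hmem
  rintro _ ⟨s, hs, t, ht, rfl⟩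
  exact ⟨s, hs, t, ht, rfl⟩

end Bilinear

end Literature.AlgebraicGeometry.Pohlmann1968

end
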